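import Summits.QuantumFields.YangMills.Theorems.UnitScaleTiltProp7PinnedSliceOfExactCorrector
import Summits.QuantumFields.YangMills.Theorems.UnitScaleTiltProp7SmoothUntwistEnRows
import HarnessLib

/-!
# Route `UnitScaleTilt`, crux K1 «MinimiserStabilityRegPr» (stmt-QuantumFields-19200), route-R E′ path (α′): THE (E1-e) KNIT ∘ U7 — the (E1) conjunct «PINNED SLICE THEOREM» of
# ✓ `Prop7PV3EOfPinnedSliceAndZetaRow.stub_PV3E_of_pinnedSliceAndZetaRow` FOR THE COMPETITOR `(e^{iA₀}W)^u` (print's Landau form after [B-RegSp] Thm 2), from the knit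
# ✓ `Prop7PinnedSliceOfExactCorrector.pinnedSlice_member` (px13 g3, p680353) at the untwisted start ✓ `Prop7SmoothUntwistEnRows.exists_untwistedStart_En_T3` (w1 g12, p680485):
# the knit's chart-row letter `X, hE1, hEβ, hEdiv` is DISCHARGED by w1's theorem; displayed remain print's rows for `A₀`, `u`, the frames, the corrector rows (hK),(hK₂), the windows

Cell `ym3-torus`, width seat `ym3-torus-px13` (gen 3); OFFER «(E1-e) KNIT ∘ U7» (bus 2026-08-29 00:06Z; w1 g12 00:05Z «→ px13 g3: take X := emb15 W (expHermField D‴)»).  THEOREMS ONLY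
(0 `def`, 0 `sorry`, 0 `instance`); `--supports stmt-QuantumFields-19200`, count-neutral.  YM₃ on T³ is a ladder rung (R3), not the Clay problem; nothing here claims the stub, the
crux, d = 4 or the gap; (E1) is NOT closed by this file — its remaining rows are DISPLAYED.

WHAT IS PROVED (ns `…Theorems.Prop7PinnedSliceOfUntwistedStart`): ★★★ `pinnedSlice_of_untwistedStart` — GIVEN, for a run `K`, `1 ≤ K − n`, an `SU(2)` field `W` on the finest torus:
print's rows of ✓ `exists_untwistedStart_En_T3` VERBATIM (the Landau datum `A₀` Hermitian-traceless with `ℓ‖A₀‖ ≤ s₀ ≤ 1∕64`, `ℓ²‖D*_𝒰A₀‖ ≤ s₁′` ([B-RegSp] (1.36)); the gauge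
transformation `u` with `(e^{iA₀}W)^u ∈ (6)(e) ∩ 𝔅_k(V)` and centre values `dist1 (u c_y) ≤ σ ≤ 1∕1024` ((1.72)); unit frames `Fr` with the block rows `a₀, a₁` (`ℓa₀ ≤ c₀`, `ℓ²a₁ ≤ c₁`));
the knit's torus-potential letter `d` with its descent row; the corrector rows (hK),(hK₂) for every characterised `(I, L)`; any `s` dominating w1's two printed constants
`S₁ = s₀ + (1+2s₀)(1+6σ)K₁`, `S₂ = s₁′ + d(K₂ + 9K₁² + 36σK₂) + d(6K₁s₀ + 4s₀(1+6σ)K₁)` with `40s ≤ ℓ` and the windows `1200·C_L·s ≤ 1`, `C_L·1600·(7C_L s + s) ≤ 1∕2` —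
THEN `∃ Y ∈ (6)(e) ∩ 𝔅_k(V)` with `A((e^{iA₀}W)^u) = A(Y)`, `‖↑(Y_bW_b⁻¹) − 1‖ ≤ (2s + 6C_L s)·ℓ⁻¹`, and the exact `S_H` clause off the `(K−n)`-centres (the (E1) body VERBATIM).
PROOF.  `exists_untwistedStart_En_T3` supplies `X := emb15 W (expHermField D‴)` on the fibre with the competitor's action and the three chart rows at `S₁`, `S₂`; `pinnedSlice_member`
at `s` does the rest.  HONEST SCOPE.  A one-step composition; constants generous; every analytic row above is displayed with a named owner (Thm-2 lineage: w1; (hK),(hK₂): routeR-w3;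
windows: ★p1).

References: T. Bałaban, CMP 102 (1985) 277–309 [Balaban1985Variational] (Prop. 7 p.299, (4)–(7) p.278); CMP 99 (1985) 75–102 [Balaban1985RegularSpaces] ((1.29)–(1.30) p.81,
(1.36) p.82, (1.72) p.88, Thm 2 p.83); CMP 98 (1985) 17–51 [Balaban1985Averaging] ((21)–(23) p.21); CMP 99 (1985) 389–434 [Balaban1985BackgroundPropagators] ((3.8) p.392).
-/

set_option autoImplicit false

noncomputable section

open scoped BigOperators Matrix.Norms.L2Operator Matrix
open NormedSpace

namespace Summit.QuantumFields.YangMills.Theorems.Prop7PinnedSliceOfUntwistedStart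

open Literature.MathematicalPhysics.QuantumFieldTheory.Balaban1983to89
open Literature.MathematicalPhysics.QuantumFieldTheory.Balaban1983to89.T3ContinuumYM3Torus
open Literature.MathematicalPhysics.QuantumFieldTheory.Balaban1983to89.T3PrintedRegularMinimiser (regFibrePr)
open Literature.MathematicalPhysics.QuantumFieldTheory.Balaban1983to89.T3SectALandauChart (emb15)
open T4Continuum
open MatrixLog (mlog)
open B9Eq39Adjoint (covD divB)
open B9TorusCalculus (torusT)
open B15DeterminingSets (embIter)
open B10Eq27TorusAxialLog (unitsField toUField)
open B5Eq118OneStroke (iterBlockOf)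
open Summit.QuantumFields.YangMills.Theorems.Prop7TPrint (expHermField)
open Summit.QuantumFields.YangMills.Theorems.Prop7SmoothUntwistEnRows (exists_untwistedStart_En_T3)
open Summit.QuantumFields.YangMills.Theorems.Prop7PinnedSliceOfExactCorrector (pinnedSlice_member)

/-- ★★★ **THE PINNED SLICE THEOREM (E1) FOR THE COMPETITOR `(e^{iA₀}W)^u`, MODULO PRINT'S ROWS, THE CORRECTOR ROWS AND THE WINDOWS** — the knit ✓ `pinnedSlice_member` at the
untwisted start ✓ `exists_untwistedStart_En_T3`; conclusion = the (E1) body of ✓ `stub_PV3E_of_pinnedSliceAndZetaRow` with `W′ := (e^{iA₀}W)^u`, `sQ := 2s + 6·C_L·s`.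
[cite: Balaban1985Variational, Prop. 7 p.299, (4)-(7) p.278; Balaban1985RegularSpaces, (1.29)-(1.30) p.81, (1.36) p.82, (1.72) p.88; Balaban1985Averaging, (21)-(23) p.21] -/
theorem pinnedSlice_of_untwistedStart (F : T3Family) {n K : ℕ} (h : n ≤ K) (hk1 : 1 ≤ K - n) {e s₀ s₁' σ a₀ a₁ c₀ c₁ : ℝ} (he : 0 ≤ e)
    -- print's rows for the competitor `(e^{iA₀}W)^u`: ✓ `exists_untwistedStart_En_T3`'s hypotheses VERBATIM
    {V : GaugeField (F.P n) 0 (Matrix.specialUnitaryGroup (Fin 2) ℂ)} (W : GaugeField (F.P K) 0 (Matrix.specialUnitaryGroup (Fin 2) ℂ))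
    (A₀ : PBond (F.P K) 0 → Matrix (Fin 2) (Fin 2) ℂ) (hA0 : ∀ b, (A₀ b).IsHermitian ∧ Matrix.trace (A₀ b) = 0)
    (hs₀ : ((((F.P K).L ^ (K - n) : ℕ)) : ℝ) * ‖(fun (μ : Fin (F.P K).d) (z : Site (F.P K) 0) => A₀ ⟨z, μ⟩)‖ ≤ s₀) (hs₀' : s₀ ≤ 1 / 64)
    (hs₁ : ((((F.P K).L ^ (K - n) : ℕ)) : ℝ) ^ 2 * ‖(fun x => divB (torusT (F.P K) 0) (fun κ z => unitsField (toUField W) ⟨z, κ⟩) (fun μ z => A₀ ⟨z, μ⟩) x)‖ ≤ s₁')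
    (u : GaugeTransf (F.P K) 0 (Matrix.specialUnitaryGroup (Fin 2) ℂ)) (hXu : GaugeField.gaugeAct u (emb15 W (expHermField A₀)) ∈ regFibrePr F n K h e V)
    (hσ : ∀ y : Site (F.P K) (K - n), dist1 (u (embIter (K - n) y)) ≤ σ) (hσ0 : σ ≤ 1 / 1024) (hσc : ((6 + 2 * c₀) * (2 * σ)) ≤ 1 / 256)
    (Fr : Site (F.P K) (K - n) → Site (F.P K) 0 → (Matrix (Fin 2) (Fin 2) ℂ)ˣ)
    (hFr : ∀ y z, ‖(Fr y z : Matrix (Fin 2) (Fin 2) ℂ)‖ ≤ 1 ∧ ‖(((Fr y z)⁻¹ : (Matrix (Fin 2) (Fin 2) ℂ)ˣ) : Matrix (Fin 2) (Fin 2) ℂ)‖ ≤ 1) (hFr1 : ∀ y, Fr y (embIter (K - n) y) = 1)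
    (ha₀ : 0 ≤ a₀) (ha₁ : 0 ≤ a₁) (hc₀ : ((((F.P K).L ^ (K - n) : ℕ)) : ℝ) * a₀ ≤ c₀) (hc₁ : ((((F.P K).L ^ (K - n) : ℕ)) : ℝ) ^ 2 * a₁ ≤ c₁)
    (hA : ∀ (y : Site (F.P K) (K - n)) (z : Site (F.P K) 0), (∀ ν : Fin (F.P K).d, (y ν = (iterBlockOf (K - n) (fun κ => z κ - (((((F.P K).L ^ (K - n) - 1) / 2 : ℕ)) : ZMod ((F.P K).sitesPerDir 0)))) ν - 1 ∨ y ν = (iterBlockOf (K - n) (fun κ => z κ - (((((F.P K).L ^ (K - n) - 1) / 2 : ℕ)) : ZMod ((F.P K).sitesPerDir 0)))) ν ∨ y ν = (iterBlockOf (K - n) (fun κ => z κ - (((((F.P K).L ^ (K - n) - 1) / 2 : ℕ)) : ZMod ((F.P K).sitesPerDir 0)))) ν + 1 ∨ y ν = (iterBlockOf (K - n) (fun κ => z κ - (((((F.P K).L ^ (K - n) - 1) / 2 : ℕ)) : ZMod ((F.P K).sitesPerDir 0)))) ν + 2)) → ∀ μ : Fin (F.P K).d,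
      ‖(((Fr y z)⁻¹ * unitsField (toUField W) ⟨z, μ⟩ * Fr y (torusT (F.P K) 0 μ z) : (Matrix (Fin 2) (Fin 2) ℂ)ˣ) : Matrix (Fin 2) (Fin 2) ℂ) - 1‖ ≤ a₀
      ∧ ‖(((Fr y ((torusT (F.P K) 0 μ).symm z))⁻¹ * unitsField (toUField W) ⟨(torusT (F.P K) 0 μ).symm z, μ⟩ * Fr y z : (Matrix (Fin 2) (Fin 2) ℂ)ˣ) : Matrix (Fin 2) (Fin 2) ℂ) - 1‖ ≤ a₀
      ∧ ‖(((Fr y z)⁻¹ * unitsField (toUField W) ⟨z, μ⟩ * Fr y (torusT (F.P K) 0 μ z) : (Matrix (Fin 2) (Fin 2) ℂ)ˣ) : Matrix (Fin 2) (Fin 2) ℂ)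
          - (((Fr y ((torusT (F.P K) 0 μ).symm z))⁻¹ * unitsField (toUField W) ⟨(torusT (F.P K) 0 μ).symm z, μ⟩ * Fr y z : (Matrix (Fin 2) (Fin 2) ℂ)ˣ) : Matrix (Fin 2) (Fin 2) ℂ)‖ ≤ a₁)
    -- the torus potential letter of the weight (any `d` with the descent row)
    (d : Site (F.P K) 0 → ℕ)
    (hd : ∀ x : Site (F.P K) 0, x ∉ Set.range (embIter (K - n)) →
      ∃ μ : Fin (F.P K).d, d (torusT (F.P K) 0 μ x) + 1 ≤ d x ∨ d ((torusT (F.P K) 0 μ).symm x) + 1 ≤ d x)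
    -- the corrector's analytic rows, for every characterised (I, L)
    {cI c₂ : ℝ} (hcI : 0 ≤ cI) (hc₂ : 0 ≤ c₂)
    (hKrows : ∀ (I : (Site (F.P K) 0 → Matrix (Fin 2) (Fin 2) ℂ) →+ (Site (F.P K) 0 → Matrix (Fin 2) (Fin 2) ℂ))
        (L : (Fin (F.P K).d → Site (F.P K) 0 → Matrix (Fin 2) (Fin 2) ℂ) →+ (Site (F.P K) 0 → Matrix (Fin 2) (Fin 2) ℂ)),
      (∀ A φ, (∀ x, divB (torusT (F.P K) 0) (fun κ z => unitsField (toUField W) ⟨z, κ⟩)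
            (fun μ => covD (torusT (F.P K) 0) (fun κ z => unitsField (toUField W) ⟨z, κ⟩) μ φ) x
          = divB (torusT (F.P K) 0) (fun κ z => unitsField (toUField W) ⟨z, κ⟩) A x) → L A = φ - I φ) →
      (∀ (A) (y : Site (F.P K) (K - n)), L A (embIter (K - n) y) = 0) →
      (∀ φ, ∀ x : Site (F.P K) 0, x ∉ Set.range (embIter (K - n)) →
        divB (torusT (F.P K) 0) (fun κ z => unitsField (toUField W) ⟨z, κ⟩)
          (fun μ => covD (torusT (F.P K) 0) (fun κ z => unitsField (toUField W) ⟨z, κ⟩) μ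
            (fun y => divB (torusT (F.P K) 0) (fun κ z => unitsField (toUField W) ⟨z, κ⟩)
              (fun ν => covD (torusT (F.P K) 0) (fun κ z => unitsField (toUField W) ⟨z, κ⟩) ν (I φ)) y)) x = 0) →
      (∀ (A) (μ : Fin (F.P K).d) (x : Site (F.P K) 0),
          ‖covD (torusT (F.P K) 0) (fun κ z => unitsField (toUField W) ⟨z, κ⟩) μ (L A) x‖
            ≤ cI * (F.L : ℝ) ^ (K - n) * ‖(fun x => divB (torusT (F.P K) 0) (fun κ z => unitsField (toUField W) ⟨z, κ⟩) A x)‖) ∧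
      (∀ A, ‖(fun x => ((min (d x : ℝ) ((F.L : ℝ) ^ (K - n)) : ℝ) : ℂ) •
            divB (torusT (F.P K) 0) (fun κ z => unitsField (toUField W) ⟨z, κ⟩)
              (fun μ y => (-Complex.I) • covD (torusT (F.P K) 0) (fun κ z => unitsField (toUField W) ⟨z, κ⟩) μ (L A) y) x)‖
            ≤ c₂ * (F.L : ℝ) ^ (K - n) * ‖(fun x => divB (torusT (F.P K) 0) (fun κ z => unitsField (toUField W) ⟨z, κ⟩) A x)‖))
    -- any `s` dominating the two printed chart constants `S₁`, `S₂` of ✓ `exists_untwistedStart_En_T3`, windowed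
    {s : ℝ} (hS₁ : (s₀ + (1 + 2 * s₀) * ((1 + 6 * σ) * ((6 + 2 * c₀) * (2 * σ)))) ≤ s)
    (hS₂ : (s₁' + ((F.P K).d : ℝ) * (((2 * (c₁ + 2 * c₀ ^ 2) + 24 * c₀ + 24) * (2 * σ)) + 9 * ((6 + 2 * c₀) * (2 * σ)) ^ 2 + 36 * σ * ((2 * (c₁ + 2 * c₀ ^ 2) + 24 * c₀ + 24) * (2 * σ)))
      + ((F.P K).d : ℝ) * (6 * ((6 + 2 * c₀) * (2 * σ)) * s₀ + 4 * s₀ * ((1 + 6 * σ) * ((6 + 2 * c₀) * (2 * σ))))) ≤ s)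
    (hs40 : 40 * s ≤ (F.L : ℝ) ^ (K - n))
    -- the windows
    (hwin1 : 1200 * max (3 / 2 * cI) (max cI c₂) * s ≤ 1)
    (hwin2 : max (3 / 2 * cI) (max cI c₂) * (400 * (1 + 3)) * (7 * max (3 / 2 * cI) (max cI c₂) * s + s) ≤ 1 / 2) :
    ∃ Y : GaugeField (F.P K) 0 (Matrix.specialUnitaryGroup (Fin 2) ℂ), Y ∈ regFibrePr F n K h e V ∧ wilsonAction4 (GaugeField.gaugeAct u (emb15 W (expHermField A₀))) = wilsonAction4 Y ∧
      (∀ b : PBond (F.P K) 0, ‖((Y b * (W b)⁻¹ : Matrix.specialUnitaryGroup (Fin 2) ℂ) : Matrix (Fin 2) (Fin 2) ℂ) - 1‖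
        ≤ (2 * s + 6 * max (3 / 2 * cI) (max cI c₂) * s) * ((F.L : ℝ) ^ (K - n))⁻¹) ∧
      (∀ x : Site (F.P K) 0, x ∉ Set.range (embIter (K - n)) →
        divB (torusT (F.P K) 0) (fun κ z => unitsField (toUField W) ⟨z, κ⟩)
          (fun μ z => covD (torusT (F.P K) 0) (fun κ z => unitsField (toUField W) ⟨z, κ⟩) μ
            (fun y => divB (torusT (F.P K) 0) (fun κ z => unitsField (toUField W) ⟨z, κ⟩)
              (fun κ z => Complex.I • ((-Complex.I) • mlog ((Y ⟨z, κ⟩ * (W ⟨z, κ⟩)⁻¹ : Matrix.specialUnitaryGroup (Fin 2) ℂ) : Matrix (Fin 2) (Fin 2) ℂ))) y) z) x = 0) := by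
  obtain ⟨D, _, hX, hAX, _, hE1, hEβ, hEdiv⟩ :=
    exists_untwistedStart_En_T3 F h hk1 he W A₀ hA0 hs₀ hs₀' hs₁ u hXu hσ hσ0 hσc Fr hFr hFr1 ha₀ ha₁ hc₀ hc₁ hA
  exact pinnedSlice_member F h he V W _ _ hX hAX hE1 (fun μ y => (hEβ μ y).trans hS₁) (fun x => (hEdiv x).trans hS₂) hs40 d hd hcI hc₂
    hKrows hwin1 hwin2

end Summit.QuantumFields.YangMills.Theorems.Prop7PinnedSliceOfUntwistedStart

end
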